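import Summits.QuantumAdvantage.QuantumAdvantage.Theorems.LinnikCubicClassGroupsDegreeOnePrimesEscapeNonsplitPrime
import Summits.QuantumAdvantage.QuantumAdvantage.Theorems.LinnikCubicClassGroupsDegreeOnePrimesEscapeQuarticS4Closure
import HarnessLib

/-!
# The least prime that does not split completely in an ARBITRARY number field is `≤ |d_K|^{L(n)}`

Topic `Summits/QuantumAdvantage/QuantumAdvantage/Theorems`, cell B2b-1 (linnik-cubic), PART A (gen 8);
helper toward the crux `DegreeOnePrimesEscape` (stmt-QuantumAdvantage-11543) of route
`LinnikCubicClassGroups`.  HONEST FRAMING: the value of this file is a THEOREM (kernel-checked, GRH-free,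
Siegel-free, no hypothesis) — NOT summit progress.

**Theorem** (`exists_nonsplitPrime_le_of_finrank`).  For every `n > 1` there is `L = L(n) > 0` such
that every number field `K` of degree `n` (Galois or not) has a prime `p ≤ |d_K|^{L}`, `p ∤ d_K`, that
does NOT split completely in `K`: fewer than `n` primes of `K` above `p` have residue degree one, so
some prime above `p` has residue degree `≥ 2` (`exists_inertiaDeg_ge_two_le_of_finrank`).

Proof.  Let `N` be the Galois closure of `K` (`exists_galoisClosure`: degree `m ≤ n!`, the embedded
copies of `K` separate `Gal(N/ℚ)`, `|d_N| ≤ |d_K|^m`).  By `exists_nonsplitPrime_le` (the one-sided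
principle for the regular character: only the upper bound `θ_N ≤ (1+η)x` is used) there is
`p ≤ |d_N|^{L(m)}`, `p ∤ d_N`, with `Frob_p ≠ 1`.  If `p` split completely in `K`, then by Perlis'
dictionary `c_{Gal(N/f(K))}(Frob_p) = |Gal(N/ℚ)|` for EVERY embedded copy `f(K)`, i.e. `Frob_p` fixes
every `f(K)`, whence `Frob_p = 1` — a contradiction.  This is the statement of X. Li, *The smallest
prime that does not split completely in a number field* (Algebra Number Theory 6 (2012)), there with
an explicit exponent by the geometry of numbers; new here is only the kernel-checked proof (inexplicit).

References: J. C. Lagarias, H. L. Montgomery, A. M. Odlyzko, Invent. Math. 54 (1979)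
[LagariasMontgomeryOdlyzko1979]; R. Perlis, J. Number Theory 9 (1977) [Perlis1977].
-/

noncomputable section

open scoped NumberField nonZeroDivisors
open Finset Real Ideal NumberField
open Literature.NumberTheory.NumberFields Literature.NumberTheory.LFunctions
  Literature.NumberTheory.LFunctions.NumberField

namespace Summit.QuantumAdvantage.QuantumAdvantage.Theorems.DegreeOnePrimesEscape

/-! ### The Galois closure of a number field, with its discriminant bound -/

/-- Transport of `Algebra.IsAlgebraic` along an equality of algebra structures. -/
private theorem isAlgebraic_of_algebra_eq'' {F L : Type*} [Field F] [Field L] {A : Algebra F L}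
    (B : Algebra F L) (h : A = B) (hA : @Algebra.IsAlgebraic F L _ _ A) :
    @Algebra.IsAlgebraic F L _ _ B := by
  subst h; exact hA

/-- The normal closure of a finite extension `K/F` of a perfect field inside a normal `L/F` is
Galois over `F`. -/
private theorem isGalois_normalClosure_of_perfectField'' (F K L : Type*) [Field F] [Field K]
    [Field L] [Algebra F K] [Algebra F L] [FiniteDimensional F K] [Normal F L] [PerfectField F] :
    IsGalois F (IntermediateField.normalClosure F K L) where

/-- Abstract step: realign the `ℚ`-algebra structure and collect the data of a Galois closure. -/
private theorem galoisClosure_of_inputs (K : Type) [Field K] [NumberField K]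
    (M : Type) [Field M] {alg : Algebra ℚ M} (hfin : FiniteDimensional ℚ M) (hG : IsGalois ℚ M)
    (hcard : Nat.card (M ≃ₐ[ℚ] M) ≤ (Module.finrank ℚ K).factorial)
    (hsep : ∀ s : M ≃ₐ[ℚ] M, s ≠ 1 → ∃ f : K →ₐ[ℚ] M, s ∉ f.fieldRange.fixingSubgroup)
    (f₀ : K →ₐ[ℚ] M) :
    ∃ (N : Type) (_ : Field N) (_ : NumberField N), IsGalois ℚ N ∧
      Module.finrank ℚ N ≤ (Module.finrank ℚ K).factorial ∧
      Module.finrank ℚ K ≤ Module.finrank ℚ N ∧ Nonempty (K →ₐ[ℚ] N) ∧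
      (∀ s : N ≃ₐ[ℚ] N, s ≠ 1 → ∃ f : K →ₐ[ℚ] N, s ∉ f.fieldRange.fixingSubgroup) ∧
      (NumberField.discr N).natAbs ≤ (NumberField.discr K).natAbs ^ Module.finrank ℚ N := by
  have hcz : CharZero M := charZero_of_injective_algebraMap (algebraMap ℚ M).injective
  obtain rfl : alg = DivisionRing.toRatAlgebra := Subsingleton.elim _ _
  haveI hNF : NumberField M := @NumberField.mk M _ hcz hfin
  have hGal : Nat.card (M ≃ₐ[ℚ] M) = Module.finrank ℚ M := IsGalois.card_aut_eq_finrank ℚ M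
  have hKM : Module.finrank ℚ K ≤ Module.finrank ℚ M :=
    LinearMap.finrank_le_finrank_of_injective (f := f₀.toLinearMap) f₀.toRingHom.injective
  exact ⟨M, inferInstance, hNF, hG, hGal ▸ hcard, hKM, ⟨f₀⟩, hsep,
    natAbs_discr_le_pow_of_separating K M hsep⟩

/-- **The Galois closure of a number field**: for every number field `K` there is a Galois number
field `N` with `[K:ℚ] ≤ [N:ℚ] ≤ [K:ℚ]!`, an embedding `K → N`, in which the embedded copies of `K`
separate `Gal(N/ℚ)`, and `|d_N| ≤ |d_K|^{[N:ℚ]}`. -/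
theorem exists_galoisClosure (K : Type) [Field K] [NumberField K] :
    ∃ (N : Type) (_ : Field N) (_ : NumberField N), IsGalois ℚ N ∧
      Module.finrank ℚ N ≤ (Module.finrank ℚ K).factorial ∧
      Module.finrank ℚ K ≤ Module.finrank ℚ N ∧ Nonempty (K →ₐ[ℚ] N) ∧
      (∀ s : N ≃ₐ[ℚ] N, s ≠ 1 → ∃ f : K →ₐ[ℚ] N, s ∉ f.fieldRange.fixingSubgroup) ∧
      (NumberField.discr N).natAbs ≤ (NumberField.discr K).natAbs ^ Module.finrank ℚ N := by
  haveI : IsAlgClosure ℚ (AlgebraicClosure ℚ) :=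
    ⟨inferInstance, isAlgebraic_of_algebra_eq'' _ (Subsingleton.elim _ _)
      (AlgebraicClosure.isAlgebraic ℚ)⟩
  have hcard := card_algEquiv_normalClosure_le_factorial ℚ K (AlgebraicClosure ℚ)
  rw [← Nat.card_eq_fintype_card] at hcard
  exact galoisClosure_of_inputs K (IntermediateField.normalClosure ℚ K (AlgebraicClosure ℚ))
    (normalClosure.is_finiteDimensional ℚ K (AlgebraicClosure ℚ))
    (isGalois_normalClosure_of_perfectField'' ℚ K (AlgebraicClosure ℚ)) hcard
    (fun _ hs => exists_not_mem_fixingSubgroup_fieldRange ℚ K (AlgebraicClosure ℚ) hs)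
    ((normalClosure.algHomEquiv ℚ K (AlgebraicClosure ℚ)).symm IsAlgClosed.lift)

/-! ### Complete splitting transfers from `K` to its Galois closure (at `p ∤ d_N`) -/

/-- **If `p ∤ d_N` splits completely in `K` then `Frob_p = 1` in the Galois closure.** Let `N/ℚ` be
Galois, the embedded copies of `K` separating `Gal(N/ℚ)`, `Q ∣ p` a prime of `N` with trivial inertia
and arithmetic Frobenius `φ`.  If `a_K(p) ≥ [K:ℚ]` then `φ = 1` (Perlis' dictionary for each copy
`f(K)`: `|Gal(N/f K)|·a_K(p) = c_{Gal(N/fK)}(φ) ≤ |Gal(N/ℚ)| = |Gal(N/fK)|·[K:ℚ]`, with equality only if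
`φ` fixes `f(K)`). -/
theorem frob_eq_one_of_count_one_ge {K : Type} [Field K] [NumberField K] {N : Type} [Field N]
    [NumberField N] [IsGalois ℚ N]
    (hsep : ∀ s : N ≃ₐ[ℚ] N, s ≠ 1 → ∃ f : K →ₐ[ℚ] N, s ∉ f.fieldRange.fixingSubgroup)
    {p : ℕ} (hp : p.Prime) (Q : Ideal (𝓞 N)) [Q.IsMaximal] [Q.LiesOver (span {(p : ℤ)})]
    {φ : N ≃ₐ[ℚ] N} (hφ : IsArithFrobAt ℤ φ Q) (hI : Q.inertia (N ≃ₐ[ℚ] N) = ⊥)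
    (hcount : Module.finrank ℚ K ≤ (splittingType K p).count 1) : φ = 1 := by
  classical
  by_contra hne
  obtain ⟨f, hf⟩ := hsep φ hne
  -- the dictionary for the copy `f(K)`
  have hk := card_fixingSubgroup_mul_count_one_splittingType f.fieldRange hp Q hφ hI
  have hT : splittingType f.fieldRange p = splittingType K p :=
    (ArithmeticallyEquivalent.of_algEquiv f.equivFieldRange p hp).symm
  rw [hT] at hk
  have hS : Nat.card f.fieldRange.fixingSubgroup = Module.finrank f.fieldRange N :=
    IsGalois.card_fixingSubgroup_eq_finrank f.fieldRange
  have htower : Module.finrank ℚ K * Module.finrank f.fieldRange N = Module.finrank ℚ N :=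
    finrank_mul_finrank_fieldRange K N f
  have hG : Nat.card (N ≃ₐ[ℚ] N) = Module.finrank ℚ N := IsGalois.card_aut_eq_finrank ℚ N
  -- the count `c_{S_f}(φ)` misses `g = 1`, so it is `< |G|`
  have hlt : Nat.card {g : N ≃ₐ[ℚ] N // g * φ * g⁻¹ ∈ f.fieldRange.fixingSubgroup} <
      Nat.card (N ≃ₐ[ℚ] N) :=
    Finite.card_subtype_lt (x := (1 : N ≃ₐ[ℚ] N)) (by rwa [one_mul, inv_one, mul_one])
  -- but it is `≥ |S_f| · [K:ℚ] = |G|`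
  have hge : Nat.card (N ≃ₐ[ℚ] N) ≤
      Nat.card {g : N ≃ₐ[ℚ] N // g * φ * g⁻¹ ∈ f.fieldRange.fixingSubgroup} := by
    rw [← hk, hS, hG, ← htower, mul_comm]
    exact Nat.mul_le_mul_left _ hcount
  omega

/-! ### The theorem -/

/-- **The least prime that does not split completely, for every number field of degree `n > 1`**:
there is `L = L(n) > 0` such that every number field `K` of degree `n` has a prime `p ≤ |d_K|^{L}`,
`p ∤ d_K`, with fewer than `n` degree-one primes of `K` above it.  GRH-free, Siegel-free, no hypothesis.
[cite: LagariasMontgomeryOdlyzko1979, Theorem 1.1] -/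
theorem exists_nonsplitPrime_le_of_finrank (n : ℕ) (hn : 1 < n) :
    ∃ L : ℝ, 0 < L ∧ ∀ (K : Type) [Field K] [NumberField K], Module.finrank ℚ K = n →
      ∃ p : ℕ, p.Prime ∧ (p : ℝ) ≤ ((NumberField.discr K).natAbs : ℝ) ^ L ∧
        ¬ ((p : ℤ) ∣ NumberField.discr K) ∧ (splittingType K p).count 1 < n := by
  classical
  -- one exponent for every possible degree `m ≤ n!` of the closure
  have hdeg : ∀ m : ℕ, ∃ L : ℝ, 0 < L ∧ (1 < m → ∀ (N : Type) [Field N] [NumberField N]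
      [IsGalois ℚ N], Module.finrank ℚ N = m →
        ∃ p : ℕ, p.Prime ∧ (p : ℝ) ≤ ((NumberField.discr N).natAbs : ℝ) ^ L ∧
          ¬ ((p : ℤ) ∣ NumberField.discr N) ∧ (splittingType N p).count 1 = 0) := by
    intro m
    by_cases hm : 1 < m
    · obtain ⟨L, hL, h⟩ := exists_nonsplitPrime_le m hm
      exact ⟨L, hL, fun _ => h⟩
    · exact ⟨1, one_pos, fun h => absurd h hm⟩
  choose Lf hLf hnon using hdeg
  set L : ℝ := (n.factorial : ℝ) * ∑ m ∈ Finset.range (n.factorial + 1), Lf m with hL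
  have hsum1 : ∀ m ≤ n.factorial, Lf m ≤ ∑ m ∈ Finset.range (n.factorial + 1), Lf m := fun m hm =>
    Finset.single_le_sum (f := Lf) (fun i _ => (hLf i).le)
      (Finset.mem_range.mpr (Nat.lt_succ_of_le hm))
  have hfac1 : (1 : ℝ) ≤ n.factorial := by exact_mod_cast Nat.succ_le_of_lt (Nat.factorial_pos n)
  have hLpos : 0 < L := by
    have : 0 < ∑ m ∈ Finset.range (n.factorial + 1), Lf m :=
      lt_of_lt_of_le (hLf 0) (hsum1 0 (Nat.zero_le _))
    rw [hL]; positivity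
  refine ⟨L, hLpos, fun K _ _ hK => ?_⟩
  obtain ⟨N, _, _, hGal, hNle, hKN, ⟨f₀⟩, hsep, hdN⟩ := exists_galoisClosure K
  haveI := hGal
  set m := Module.finrank ℚ N with hm
  rw [hK] at hNle hKN
  have hm1 : 1 < m := lt_of_lt_of_le hn hKN
  obtain ⟨p, hp, hpx, hpN, hcount⟩ := hnon m hm1 N rfl
  -- sizes: `|d_N|^{L(m)} ≤ (|d_K|^m)^{L(m)} ≤ |d_K|^L`
  set d : ℝ := ((NumberField.discr K).natAbs : ℝ) with hd
  have hd3 : (3 : ℝ) ≤ d := three_le_natAbs_discr_real K (by rw [hK]; exact hn)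
  have hd1 : (1 : ℝ) ≤ d := by linarith
  have hdNR : ((NumberField.discr N).natAbs : ℝ) ≤ d ^ (m : ℝ) := by
    rw [Real.rpow_natCast, hd]; exact_mod_cast hdN
  have hpx' : (p : ℝ) ≤ d ^ L := by
    have h1 : ((NumberField.discr N).natAbs : ℝ) ^ Lf m ≤ (d ^ (m : ℝ)) ^ Lf m :=
      Real.rpow_le_rpow (Nat.cast_nonneg _) hdNR (hLf m).le
    have h2 : (d ^ (m : ℝ)) ^ Lf m = d ^ ((m : ℝ) * Lf m) := by
      rw [← Real.rpow_mul (by linarith)]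
    have h3 : (m : ℝ) * Lf m ≤ L := by
      rw [hL]
      have hmf : (m : ℝ) ≤ n.factorial := by exact_mod_cast hNle
      exact mul_le_mul hmf (hsum1 m hNle) (hLf m).le (by positivity)
    calc (p : ℝ) ≤ ((NumberField.discr N).natAbs : ℝ) ^ Lf m := hpx
      _ ≤ d ^ ((m : ℝ) * Lf m) := h2 ▸ h1
      _ ≤ d ^ L := Real.rpow_le_rpow_of_exponent_le hd1 h3
  -- `p ∤ d_K`
  have hdisc' : NumberField.discr f₀.fieldRange = NumberField.discr K :=
    (NumberField.discr_eq_discr_of_algEquiv K f₀.equivFieldRange).symm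
  have hdvd : ¬ ((p : ℤ) ∣ NumberField.discr K) := fun h =>
    hpN (h.trans (hdisc' ▸ NumberField.discr_dvd_discr f₀.fieldRange N))
  refine ⟨p, hp, hpx', hdvd, ?_⟩
  -- complete splitting in `K` would force `Frob_p = 1`, contradicting `a_N(p) = 0`
  by_contra hge
  push Not at hge
  rw [← hK] at hge
  obtain ⟨Q, hQmax, hQover, ⟨φ, hφ⟩, hI⟩ := exists_isArithFrobAt_of_not_dvd_discr (N := N) hp hpN
  have h1 := frob_eq_one_of_count_one_ge hsep hp Q hφ hI hge
  subst h1
  have hk := card_fixingSubgroup_mul_count_one_splittingType (⊤ : IntermediateField ℚ N) hp Q hφ hI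
  rw [IntermediateField.fixingSubgroup_top, Subgroup.card_bot, one_mul, splittingType_top hp,
    hcount] at hk
  have hall : Nat.card {g : N ≃ₐ[ℚ] N // g * 1 * g⁻¹ ∈ (⊥ : Subgroup (N ≃ₐ[ℚ] N))} =
      Nat.card (N ≃ₐ[ℚ] N) :=
    Nat.card_congr (Equiv.subtypeUnivEquiv fun g => by
      rw [mul_one, mul_inv_cancel]; exact Subgroup.one_mem _)
  rw [hall] at hk
  exact absurd hk.symm (Nat.pos_iff_ne_zero.mp Nat.card_pos)

/-- **Some prime of residue degree `≥ 2`, for every number field of degree `n > 1`**: with `L = L(n)`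
as above, every number field `K` of degree `n` has a prime `p ≤ |d_K|^{L}`, `p ∤ d_K`, and a prime of
`K` above `p` of residue degree `≥ 2`. [cite: LagariasMontgomeryOdlyzko1979, Theorem 1.1] -/
theorem exists_inertiaDeg_ge_two_le_of_finrank (n : ℕ) (hn : 1 < n) :
    ∃ L : ℝ, 0 < L ∧ ∀ (K : Type) [Field K] [NumberField K], Module.finrank ℚ K = n →
      ∃ p : ℕ, p.Prime ∧ (p : ℝ) ≤ ((NumberField.discr K).natAbs : ℝ) ^ L ∧
        ¬ ((p : ℤ) ∣ NumberField.discr K) ∧ ∃ f ∈ splittingType K p, 2 ≤ f := by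
  classical
  obtain ⟨L, hL, h⟩ := exists_nonsplitPrime_le_of_finrank n hn
  refine ⟨L, hL, fun K _ _ hK => ?_⟩
  obtain ⟨p, hp, hpx, hdvd, hcount⟩ := h K hK
  refine ⟨p, hp, hpx, hdvd, ?_⟩
  by_contra hno
  push Not at hno
  -- all residue degrees are `1`, so `a_K(p) = Σ T = n`
  have hall : ∀ f ∈ splittingType K p, f = 1 := fun f hf => by
    have h1 := splittingType_pos hp hf
    have h2 := hno f hf
    omega
  have hrep : splittingType K p = Multiset.replicate (Multiset.card (splittingType K p)) 1 :=
    Multiset.eq_replicate.mpr ⟨rfl, hall⟩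
  have hsum := sum_splittingType_eq_finrank hp hdvd (K := K)
  rw [hrep, Multiset.sum_replicate, smul_eq_mul, mul_one, hK] at hsum
  rw [hrep, Multiset.count_replicate_self, hsum] at hcount
  exact lt_irrefl n hcount

end Summit.QuantumAdvantage.QuantumAdvantage.Theorems.DegreeOnePrimesEscape

end
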